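import Mathlib
import Literature.Computability.Complexity.OccurrenceObstructionsIPProofs
import Literature.Computability.AlgebraicComplexity.PlethysmLifting
import Summits.ValiantsHypothesis.ValiantsHypothesis.Theorems.ValuativeGCTValuativeFlipPaddingTransferPoints
import Summits.ValiantsHypothesis.ValiantsHypothesis.Theorems.ValuativeGCTValuativeFlipTwistedInheritance
import HarnessLib

/-!
# `ValuativeGCT.ValuativeFlip` (stmt-ValiantsHypothesis-12624): rays from the bottom, II —
# the kernel of the lift modulo the ideal of the padded permanent

Wall-breaker k4 (gen 1, seat 2; axis "representation-stability transfer between `m` and `m + 1`"),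
helper file `--supports stmt-ValiantsHypothesis-12624`.

Let `n ≤ m`, `N = m + j`, `L = liftHWV m j`.  For a polynomial function `G` on `Sym^m ℂ^{m²}` and a
matrix `A ∈ Mat_{m²}` write `τ_j(G, A) := G(Δ_j(A · X₀₀^{m-n} per_n))` for the **Δ_j-twisted
evaluation** (`Δ_j` rescales the coefficient of `x^e` by `(e_top + j)!/e_top!`, BIP Lemma 5.2), and call
`A` *column-normalised* if `n < m → A · X₀₀ = X_top` (its `(0,0)`-th column is `e_top`; no condition
at the bottom `m = n`).

* `aeval_twist_eq_zero_of_liftHWV_mem` (any `G`): if `L G ∈ I(Δ_N(X₀₀^{N-n} per_n))` then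
  `τ_j(G, A) = 0` for every column-normalised `A` — the padded points `X_top^j · (A · X₀₀^{m-n} per_n)`
  are `End`-orbit points of the level-`N` padded permanent (k12 / k4 gen 1, Part F) and
  `(L G)(X_top^j · f) = G(Δ_j f)`.
* `exists_col_point_of_gl` (the reverse point construction): for `g ∈ GL_{N²}` whose `(0,0)`-th
  column is `e_top`, `g · (X₀₀^{N-n} per_n) = X_top^j · P` with `P` a form of degree `m` whose
  restriction to the segment is `A_g · (X₀₀^{m-n} per_n)` for a column-normalised `A_g ∈ Mat_{m²}`.
* `liftHWV_mem_orbitVanishingIdeal_of_forall` (`G` a highest-weight vector): conversely, if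
  `τ_j(G, A) = 0` for every column-normalised `A` then `L G ∈ I(Δ_N(X₀₀^{N-n} per_n))` — Borel
  saturation at level `N` (`mem_orbitVanishingIdeal_of_forall_col`, k4 gen 1 Part E) reduces to the
  points `g · f'` with prescribed column, where `(L G)(g · f') = τ_j(G, A_g)`.
* `liftHWV_mem_orbitVanishingIdeal_iff` — **`L G ∈ I_N ⇔ τ_j(G, ·) ≡ 0` on column-normalised points.**

So the per-side kernel at level `N` pulled back along the lift is a LEVEL-`m` object; Part III
(`…RayFromBottom`) combines this with the bijectivity of the lift (`…LiftSurjective`).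

Sources: Mulmuley–Sohoni 2001 §4–5; BLMW 2011 §5.2, §6.4; Ikenmeyer–Panova 2017 Prop. 2.6(b);
Bürgisser–Ikenmeyer–Panova 2019 Lemma 5.2–5.3, Thm. 5.4.
-/

set_option linter.dupNamespace false

namespace Summit.ValiantsHypothesis.ValiantsHypothesis.Theorems.ValuativeFlip

open scoped BigOperators
open MvPolynomial
open Literature.NumberTheory.DiophantineGeometry
open Literature.Computability.AlgebraicComplexity
open Literature.Computability.Complexity
open Literature.Barriers.ValiantsHypothesis (degIdxMap degIdxMap_val)

noncomputable section

/-! ## Small tools -/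

/-- A polynomial of `I(GL · f)` vanishes at every endomorphism-orbit point `A · f`
(`I(GL · f) = ker(genericOrbitMap)`). [Mulmuley–Sohoni 2001 §4; folklore] -/
theorem lk_aeval_formCoeff_linSubst_eq_zero {σ : Type*} [Fintype σ] [LinearOrder σ]
    {f : MvPolynomial σ ℂ} {m : ℕ} {G : MvPolynomial (DegIdx σ m) ℂ}
    (hG : G ∈ orbitVanishingIdeal f m) (A : Matrix σ σ ℂ) :
    aeval (formCoeff m (linSubst σ ℂ A f)) G = 0 := by
  rw [orbitVanishingIdeal_eq_ker_genericOrbitMap, RingHom.mem_ker] at hG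
  have hG' : genericOrbitMap f m G = 0 := hG
  rw [← eval_genericOrbitMap f m G A, hG', map_zero]

/-- Killing the variables off the segment on a linear form: `killCompl (∑_v c_v X_v) = ∑_r c_{ι r} X_r`.
[folklore] -/
theorem lk_killCompl_sum_smul_X {σ τ : Type*} [Fintype σ] [Fintype τ] [DecidableEq τ] {ι : σ → τ}
    (hι : Function.Injective ι) (c : τ → ℂ) :
    killCompl hι (∑ v, c v • (X v : MvPolynomial τ ℂ)) = ∑ r, c (ι r) • (X r : MvPolynomial σ ℂ) := by
  classical
  have hX : ∀ v, killCompl hι (X v : MvPolynomial τ ℂ) =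
      ∑ r, (if ι r = v then (X r : MvPolynomial σ ℂ) else 0) := by
    intro v
    rw [killCompl, aeval_X]
    by_cases hv : v ∈ Set.range ι
    · obtain ⟨r₀, rfl⟩ := hv
      rw [dif_pos ⟨r₀, rfl⟩, Equiv.ofInjective_symm_apply]
      simp_rw [hι.eq_iff]
      rw [Finset.sum_ite_eq' Finset.univ r₀, if_pos (Finset.mem_univ _)]
    · rw [dif_neg hv]
      symm
      refine Finset.sum_eq_zero fun r _ => ?_
      rw [if_neg (fun h => hv ⟨r, h⟩)]
  rw [map_sum]
  simp_rw [map_smul, hX, Finset.smul_sum, smul_ite, smul_zero]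
  rw [Finset.sum_comm]
  refine Finset.sum_congr rfl fun r _ => ?_
  rw [Finset.sum_ite_eq Finset.univ (ι r), if_pos (Finset.mem_univ _)]

/-! ## Forward: `L G ∈ I_N` forces the twisted evaluation to vanish on column-normalised points -/

/-- **Padded points, both cases.**  For `n ≤ m` and a column-normalised `A ∈ Mat_{m²}` (no condition
when `m = n`), `X_top^j · (A · X₀₀^{m-n} per_n)|segment` is an `End`-orbit point of the level-`m+j`
padded permanent (k12's `exists_linSubst_paddedPerFormLex_eq_paddedForm` at the bottom, k4 gen 1's
`exists_linSubst_paddedPerFormLex_eq_paddedForm_of_col` above it). [Mulmuley–Sohoni 2001 §4] -/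
theorem lk_exists_linSubst_eq_paddedForm {n m : ℕ} [NeZero m] (hnm : n ≤ m) (j : ℕ) [NeZero (m + j)]
    (A : Matrix (MatIdx m) (MatIdx m) ℂ)
    (hA : n < m → ∀ s, A s (toLex ((0 : Fin m), (0 : Fin m))) = if s = topMatIdx m then 1 else 0) :
    ∃ M : Matrix (MatIdx (m + j)) (MatIdx (m + j)) ℂ,
      linSubst (MatIdx (m + j)) ℂ M (paddedPerFormLex ℂ n (m + j)) =
        paddedForm m j (linSubst (MatIdx m) ℂ A (paddedPerFormLex ℂ n m)) := by
  rcases hnm.lt_or_eq with hlt | heq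
  · exact exists_linSubst_paddedPerFormLex_eq_paddedForm_of_col n m j hnm A (hA hlt)
  · subst heq
    exact exists_linSubst_paddedPerFormLex_eq_paddedForm n j A

/-- **Forward direction.**  If `L G = liftHWV m j G` lies in the ideal of the orbit closure of the
level-`(m+j)` padded permanent, then the Δ_j-twisted evaluation of `G` vanishes at `A · X₀₀^{m-n} per_n`
for every column-normalised `A` (`(L G)(X_top^j · f) = G(Δ_j f)`, `aeval_formCoeff_paddedForm_liftHWV`,
at the `End`-orbit points of `lk_exists_linSubst_eq_paddedForm`).  No weight hypothesis on `G`.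
[Ikenmeyer–Panova 2017 Prop. 2.6(b); Bürgisser–Ikenmeyer–Panova 2019 Lemma 5.2, Thm. 5.4] -/
theorem aeval_twist_eq_zero_of_liftHWV_mem {n m : ℕ} [NeZero m] (hnm : n ≤ m) (j : ℕ) [NeZero (m + j)]
    {G : MvPolynomial (DegIdx (MatIdx m) m) ℂ}
    (hG : liftHWV m j G ∈ orbitVanishingIdeal (paddedPerFormLex ℂ n (m + j)) (m + j))
    (A : Matrix (MatIdx m) (MatIdx m) ℂ)
    (hA : n < m → ∀ s, A s (toLex ((0 : Fin m), (0 : Fin m))) = if s = topMatIdx m then 1 else 0) :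
    aeval (fun e : DegIdx (MatIdx m) m =>
      (((e.1 (topMatIdx m) + j).descFactorial j : ℕ) : ℂ) *
        coeff e.1 (linSubst (MatIdx m) ℂ A (paddedPerFormLex ℂ n m))) G = 0 := by
  obtain ⟨M, hM⟩ := lk_exists_linSubst_eq_paddedForm hnm j A hA
  have hf : (linSubst (MatIdx m) ℂ A (paddedPerFormLex ℂ n m)).IsHomogeneous m :=
    linSubst_isHomogeneous A (paddedPerFormLex_isHomogeneous ℂ hnm)
  have h := lk_aeval_formCoeff_linSubst_eq_zero hG M
  rwa [hM, aeval_formCoeff_paddedForm_liftHWV j hf] at h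

/-! ## Backward: the reverse point construction and Borel saturation at level `m + j` -/

/-- **Reverse points.**  Let `n ≤ m`, `N = m + j`, and `g ∈ GL_{N²}` with `(0,0)`-th column `e_top`
(`g · X₀₀ = X_top`).  Then `g · (X₀₀^{N-n} per_n) = X_top^j · P` for a form `P` of degree `m` on
`ℂ^{N²}` whose restriction to the final segment (`killCompl segEmb`) is `A · (X₀₀^{m-n} per_n)` for a
column-normalised `A ∈ Mat_{m²}`: `P = X_top^{m-n} · per_n(g · X_block)`, and `A` carries, on the block
columns of level `m`, the segment parts of the block columns of `g` (and `e_top` on the padding column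
when `n < m`). [Mulmuley–Sohoni 2001 §4; Bürgisser–Ikenmeyer–Panova 2019 §1(a)] -/
theorem exists_col_point_of_gl {n m : ℕ} [NeZero m] (hnm : n ≤ m) (j : ℕ) [NeZero (m + j)]
    (g : Matrix (MatIdx (m + j)) (MatIdx (m + j)) ℂ)
    (hg : ∀ s, g s (toLex ((0 : Fin (m + j)), (0 : Fin (m + j)))) = if s = topMatIdx (m + j) then 1 else 0) :
    ∃ (A : Matrix (MatIdx m) (MatIdx m) ℂ) (P : MvPolynomial (MatIdx (m + j)) ℂ),
      (n < m → ∀ s, A s (toLex ((0 : Fin m), (0 : Fin m))) = if s = topMatIdx m then 1 else 0) ∧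
      P.IsHomogeneous m ∧
      linSubst (MatIdx (m + j)) ℂ g (paddedPerFormLex ℂ n (m + j)) = X (topMatIdx (m + j)) ^ j * P ∧
      killCompl (segEmb_strictMono (Nat.le_add_right m j)).injective P =
        linSubst (MatIdx m) ℂ A (paddedPerFormLex ℂ n m) := by
  classical
  have hmN : m ≤ m + j := Nat.le_add_right m j
  have hnN : n ≤ m + j := hnm.trans hmN
  set ι := segEmb hmN with hιdef
  have hι : Function.Injective ι := (segEmb_strictMono hmN).injective
  -- enumerations of the two blocks
  let e₁ : Fin n ≃ BlockIdx n (m + j) := (Fintype.equivFinOfCardEq (card_blockIdx hnN)).symm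
  let e₀ : Fin n ≃ BlockIdx n m := (Fintype.equivFinOfCardEq (card_blockIdx hnm)).symm
  let blk₁ : Fin n × Fin n → MatIdx (m + j) := fun ab =>
    toLex (((e₁ ab.1 : BlockIdx n (m + j)) : Fin (m + j)), ((e₁ ab.2 : BlockIdx n (m + j)) : Fin (m + j)))
  let blk₀ : Fin n × Fin n → MatIdx m := fun ab =>
    toLex (((e₀ ab.1 : BlockIdx n m) : Fin m), ((e₀ ab.2 : BlockIdx n m) : Fin m))
  have hinj₀ : Function.Injective blk₀ := by
    intro ab ab' h
    have h1 := congrArg (fun x : MatIdx m => (ofLex x).1) h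
    have h2 := congrArg (fun x : MatIdx m => (ofLex x).2) h
    simp only [blk₀, ofLex_toLex] at h1 h2
    exact Prod.ext (e₀.injective (Subtype.ext h1)) (e₀.injective (Subtype.ext h2))
  -- the level-`m` matrix, column by column
  let A : Matrix (MatIdx m) (MatIdx m) ℂ := fun r c =>
    if h : ∃ ab : Fin n × Fin n, blk₀ ab = c then g (ι r) (blk₁ (Classical.choose h))
    else if c = toLex ((0 : Fin m), (0 : Fin m)) then (if r = topMatIdx m then 1 else 0) else 0
  have hA_block : ∀ ab : Fin n × Fin n,
      linSubst (MatIdx m) ℂ A (X (blk₀ ab)) = ∑ r : MatIdx m, g (ι r) (blk₁ ab) • (X r : MvPolynomial (MatIdx m) ℂ) := by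
    intro ab
    have hex : ∃ ab' : Fin n × Fin n, blk₀ ab' = blk₀ ab := ⟨ab, rfl⟩
    have hch : Classical.choose hex = ab := hinj₀ (Classical.choose_spec hex)
    rw [linSubst_X]
    refine Finset.sum_congr rfl fun r _ => ?_
    simp only [A, dif_pos hex, hch]
  have hA_col : n < m → ∀ s, A s (toLex ((0 : Fin m), (0 : Fin m))) = if s = topMatIdx m then 1 else 0 := by
    intro hlt s
    have hnot : ¬ ∃ ab : Fin n × Fin n, blk₀ ab = toLex ((0 : Fin m), (0 : Fin m)) := by
      rintro ⟨ab, hab⟩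
      have h1 := congrArg (fun x : MatIdx m => (((ofLex x).1 : Fin m) : ℕ)) hab
      simp only [blk₀, ofLex_toLex, Fin.val_zero] at h1
      have h2 := (e₀ ab.1).2
      omega
    simp only [A, dif_neg hnot, if_true]
  -- the inner form at level `N` and its homogeneity
  set Q : MvPolynomial (MatIdx (m + j)) ℂ :=
    linSubst (MatIdx (m + j)) ℂ g (rename blk₁ (perPoly (Fin n) ℂ)) with hQdef
  have hQ : Q.IsHomogeneous n := by
    have h := (perPoly_isHomogeneous (n := Fin n) (k := ℂ)).rename_isHomogeneous (f := blk₁)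
    rw [Fintype.card_fin] at h
    exact linSubst_isHomogeneous g h
  set P : MvPolynomial (MatIdx (m + j)) ℂ := X (topMatIdx (m + j)) ^ (m - n) * Q with hPdef
  have hP : P.IsHomogeneous m := by
    have h := ((isHomogeneous_X ℂ (topMatIdx (m + j))).pow (m - n)).mul hQ
    have he : 1 * (m - n) + n = m := by omega
    rw [he] at h
    exact h
  -- the padding variable goes to the top variable
  have hg_pad : linSubst (MatIdx (m + j)) ℂ g (X (toLex ((0 : Fin (m + j)), (0 : Fin (m + j))))) =
      X (topMatIdx (m + j)) := by
    rw [linSubst_X]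
    simp_rw [hg]
    simp only [ite_smul, one_smul, zero_smul]
    rw [Finset.sum_ite_eq' Finset.univ (topMatIdx (m + j)), if_pos (Finset.mem_univ _)]
  refine ⟨A, P, hA_col, hP, ?_, ?_⟩
  · -- `g · f' = X_top^{N-n} · Q = X_top^j · P`
    rw [ti_paddedPerFormLex_eq n (m + j) e₁, map_mul, map_pow, hg_pad]
    have hpow : (X (topMatIdx (m + j)) : MvPolynomial (MatIdx (m + j)) ℂ) ^ (m + j - n) =
        X (topMatIdx (m + j)) ^ j * X (topMatIdx (m + j)) ^ (m - n) := by
      rw [← pow_add]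
      congr 1
      omega
    rw [hpow, mul_assoc]
  · -- restriction to the segment
    have hkX : killCompl hι (X (topMatIdx (m + j)) : MvPolynomial (MatIdx (m + j)) ℂ) = X (topMatIdx m) := by
      rw [← segEmb_topMatIdx hmN, ← hιdef, ← rename_X ι, killCompl_rename_app]
    have hkQ : killCompl hι Q = aeval (fun ab : Fin n × Fin n =>
        ∑ r : MatIdx m, g (ι r) (blk₁ ab) • (X r : MvPolynomial (MatIdx m) ℂ)) (perPoly (Fin n) ℂ) := by
      rw [hQdef, linSubst_rename_eq_aeval, comp_aeval_apply]
      refine congrArg (fun G => aeval G (perPoly (Fin n) ℂ)) (funext fun ab => ?_)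
      rw [linSubst_X, lk_killCompl_sum_smul_X hι]
    rw [hPdef, map_mul, map_pow, hkX, hkQ, ti_paddedPerFormLex_eq n m e₀, map_mul, map_pow,
      linSubst_rename_eq_aeval]
    have himg : (fun ab : Fin n × Fin n => linSubst (MatIdx m) ℂ A (X (blk₀ ab))) =
        fun ab => ∑ r : MatIdx m, g (ι r) (blk₁ ab) • (X r : MvPolynomial (MatIdx m) ℂ) :=
      funext hA_block
    rw [show (fun ab : Fin n × Fin n => linSubst (MatIdx m) ℂ A
        (X (toLex (((e₀ ab.1 : BlockIdx n m) : Fin m), ((e₀ ab.2 : BlockIdx n m) : Fin m))))) =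
        fun ab => linSubst (MatIdx m) ℂ A (X (blk₀ ab)) from rfl, himg]
    rcases hnm.lt_or_eq with hlt | heq
    · have hA_pad : linSubst (MatIdx m) ℂ A (X (toLex ((0 : Fin m), (0 : Fin m)))) = X (topMatIdx m) := by
        rw [linSubst_X]
        simp_rw [hA_col hlt]
        simp only [ite_smul, one_smul, zero_smul]
        rw [Finset.sum_ite_eq' Finset.univ (topMatIdx m), if_pos (Finset.mem_univ _)]
      rw [hA_pad]
    · have h0 : m - n = 0 := by omega
      rw [h0, pow_zero, pow_zero]

/-- **The lifted function at a column-prescribed point is a twisted evaluation at level `m`.**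
For `g ∈ GL_{N²}` with `(0,0)`-th column `e_top`, with `A_g`, `P` as in `exists_col_point_of_gl`:
`(L G)(g · X₀₀^{N-n} per_n) = G(Δ_j(A_g · X₀₀^{m-n} per_n))` (BIP Thm. 5.4 for the inner lift,
Lemma 5.2 for `∂_top^j ∘ X_top^j`, and `coeff_killCompl` for the renaming along the segment).
[Bürgisser–Ikenmeyer–Panova 2019 Lemma 5.2, Thm. 5.4; Ikenmeyer–Panova 2017 Prop. 2.6(b)] -/
theorem aeval_formCoeff_liftHWV_X_pow_mul {m : ℕ} [NeZero m] (j : ℕ) [NeZero (m + j)]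
    {P : MvPolynomial (MatIdx (m + j)) ℂ} (hP : P.IsHomogeneous m)
    (G : MvPolynomial (DegIdx (MatIdx m) m) ℂ) :
    aeval (formCoeff (m + j) (X (topMatIdx (m + j)) ^ j * P)) (liftHWV m j G) =
      aeval (fun e : DegIdx (MatIdx m) m =>
        (((e.1 (topMatIdx m) + j).descFactorial j : ℕ) : ℂ) *
          coeff e.1 (killCompl (segEmb_strictMono (Nat.le_add_right m j)).injective P)) G := by
  have hmN : m ≤ m + j := Nat.le_add_right m j
  have hι := (segEmb_strictMono hmN).injective
  have hq : (X (topMatIdx (m + j)) ^ j * P).IsHomogeneous (m + j) := by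
    have h := ((isHomogeneous_X ℂ (topMatIdx (m + j))).pow j).mul hP
    have he : 1 * j + m = m + j := by ring
    rw [he] at h
    exact h
  rw [liftHWV, AlgHom.comp_apply, aeval_formCoeff_innerLift _ hq, Nat.add_sub_cancel_left,
    aeval_formCoeff_rename_degIdxMap hι]
  refine congrArg (fun p : DegIdx (MatIdx m) m → ℂ => aeval p G) (funext fun e => ?_)
  rw [formCoeff_apply, coeff_killCompl, ← degIdxMap_val hι, ← formCoeff_apply,
    formCoeff_iterPderiv_X_pow_mul _ _ hP, formCoeff_apply, degIdxMap_val, coeff_killCompl,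
    ← segEmb_topMatIdx hmN, Finsupp.mapDomain_apply hι]

/-- **Backward direction.**  Let `G` be a highest-weight vector of weight `λ*` (`λ ⊢ m·δ`, at most
`m²` parts) on `ℂ[Sym^m ℂ^{m²}]`.  If the Δ_j-twisted evaluation of `G` vanishes at `A · X₀₀^{m-n} per_n`
for every column-normalised `A ∈ Mat_{m²}`, then `liftHWV m j G ∈ I(Δ_{m+j}(X₀₀^{m+j-n} per_n))`:
`L G` is a highest-weight vector at level `m + j` (`liftHWV_mem_highestWeightSpace`), so by Borel
saturation (`mem_orbitVanishingIdeal_of_forall_col`) it suffices that it vanish at `g · f'` for the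
invertible `g` with `(0,0)`-th column `e_top`, where its value is a twisted evaluation at level `m`
(`exists_col_point_of_gl`, `aeval_formCoeff_liftHWV_X_pow_mul`).
[Mulmuley–Sohoni 2001 §4; BLMW 2011 §5.2; Bürgisser–Ikenmeyer–Panova 2019 §5] -/
theorem liftHWV_mem_orbitVanishingIdeal_of_forall {n m δ : ℕ} [NeZero m] (hnm : n ≤ m)
    (lam : Nat.Partition (m * δ)) (hlam : lam.parts.card ≤ m * m) (j : ℕ) [NeZero (m + j)]
    {G : MvPolynomial (DegIdx (MatIdx m) m) ℂ}
    (hG : G ∈ highestWeightSpace (coordRep (MatIdx m) ℂ m) (partitionWeightLex m lam))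
    (h0 : ∀ A : Matrix (MatIdx m) (MatIdx m) ℂ,
      (n < m → ∀ s, A s (toLex ((0 : Fin m), (0 : Fin m))) = if s = topMatIdx m then 1 else 0) →
      aeval (fun e : DegIdx (MatIdx m) m =>
        (((e.1 (topMatIdx m) + j).descFactorial j : ℕ) : ℂ) *
          coeff e.1 (linSubst (MatIdx m) ℂ A (paddedPerFormLex ℂ n m))) G = 0) :
    liftHWV m j G ∈ orbitVanishingIdeal (paddedPerFormLex ℂ n (m + j)) (m + j) := by
  refine mem_orbitVanishingIdeal_of_forall_col (paddedPerFormLex ℂ n (m + j)) (m + j)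
    (partitionWeightLex (m + j) (rowLift lam j)) (toLex ((0 : Fin (m + j)), (0 : Fin (m + j))))
    (topMatIdx (m + j)) (le_topMatIdx (m + j)) (liftHWV_mem_highestWeightSpace lam hlam j hG) ?_
  intro g hg
  obtain ⟨A, P, hA, hP, hgP, hkP⟩ := exists_col_point_of_gl hnm j (g : Matrix (MatIdx (m + j)) (MatIdx (m + j)) ℂ) hg
  rw [hgP, aeval_formCoeff_liftHWV_X_pow_mul j hP, hkP]
  exact h0 A hA

/-- **THE KERNEL OF THE LIFT MODULO THE IDEAL IS A LEVEL-`m` OBJECT.**  For `n ≤ m`, `λ ⊢ m·δ` with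
at most `m²` parts, every `j`, and every highest-weight vector `G` of weight `λ*` on `ℂ[Sym^m ℂ^{m²}]`:
`liftHWV m j G ∈ I(Δ_{m+j}(X₀₀^{m+j-n} per_n))` **iff** the Δ_j-twisted evaluation
`G(Δ_j(A · X₀₀^{m-n} per_n))` vanishes for every column-normalised `A ∈ Mat_{m²}`
(`n < m → A · X₀₀ = X_top`).  [this file: `aeval_twist_eq_zero_of_liftHWV_mem`,
`liftHWV_mem_orbitVanishingIdeal_of_forall`] -/
theorem liftHWV_mem_orbitVanishingIdeal_iff {n m δ : ℕ} [NeZero m] (hnm : n ≤ m)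
    (lam : Nat.Partition (m * δ)) (hlam : lam.parts.card ≤ m * m) (j : ℕ) [NeZero (m + j)]
    {G : MvPolynomial (DegIdx (MatIdx m) m) ℂ}
    (hG : G ∈ highestWeightSpace (coordRep (MatIdx m) ℂ m) (partitionWeightLex m lam)) :
    liftHWV m j G ∈ orbitVanishingIdeal (paddedPerFormLex ℂ n (m + j)) (m + j) ↔
      ∀ A : Matrix (MatIdx m) (MatIdx m) ℂ,
        (n < m → ∀ s, A s (toLex ((0 : Fin m), (0 : Fin m))) = if s = topMatIdx m then 1 else 0) →
        aeval (fun e : DegIdx (MatIdx m) m =>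
          (((e.1 (topMatIdx m) + j).descFactorial j : ℕ) : ℂ) *
            coeff e.1 (linSubst (MatIdx m) ℂ A (paddedPerFormLex ℂ n m))) G = 0 :=
  ⟨fun h A hA => aeval_twist_eq_zero_of_liftHWV_mem hnm j h A hA,
    liftHWV_mem_orbitVanishingIdeal_of_forall hnm lam hlam j hG⟩

end

end Summit.ValiantsHypothesis.ValiantsHypothesis.Theorems.ValuativeFlip
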